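import Mathlib
import Literature.Computability.AlgebraicComplexity.GroupTheoreticMatMul
import Literature.Computability.AlgebraicComplexity.WordTypes
import Literature.Computability.AutomaticStructures.AutomaticBlock

/-!
# Kernel of the STPP verification for the digit-sum-sliced laser family in `ℤ/ℓ^N`

Route `MatrixMultiplication/AutomaticSTPPDesigns`, crux `stmt-MatrixMultiplication-7357`
(`AutomaticDesignBelowFourFifths`), line `digit-sum-sliced-laser`; support lemmas for the
load-bearing stub `stub_slicedSTPP` (file `…StubSlicedSTPP.lean`).

The sliced level-1 laser family of Coppersmith–Winograd's `CW_q` inside the carry-free truncated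
convolution `T_ℓ^lower` (`ℓ = q + 2`; digits `0 ↦` level `0`, `1 … q ↦` level `1`, `q+1 ↦` level
`2` on the first two legs, reversed on the third) is verified to be an `IsSTPP` family (CKSU 2005
Def. 5.1, tree orientation `(s'-t) + (t'-u) = (s-u')`) from ABSTRACT value tables:

* `slicedSTPP_two_le_weight` — a digitwise addition `x + y = z ≤ q+1` has level weight `≥ 2`
  (the support of `T_ℓ^lower` in the blocking is the six weight-2 `CW_q` patterns plus `(1,1,1)`);
* `slicedSTPP_sum_val` — `∑_t I_t = #{I=1} + 2#{I=2}`;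
* `slicedSTPP_graft_at/off/sum` — grafting a word onto an enumerated class of coordinates;
* `slicedSTPP_kernel` — given block level data separated by the pointwise-weight-2 condition
  (freeness) with total weight `2N` (types), a valuation of `ℕ`-digit vectors in `ℤ/ℓ^N` that is
  additive, injective below `ℓ` and digitwise on conserved digit sums (Kummer), and vector families
  `Av, Bv, Cv` with the right level tables, constant digit sums on the slice and readable shared
  digits, the family `A_i = [Av_i(Sl)]`, `B_i = -[Bv_i(Sl)]`, `C_i = -[Cv_i(Sl)]` is `IsSTPP` with
  blocks of size `|Sl|`.
-/

-- single-conjunct summit: the mandated namespace repeats `MatrixMultiplication`.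
set_option linter.dupNamespace false

noncomputable section

open Finset
open scoped BigOperators

namespace Summit.MatrixMultiplication.MatrixMultiplication.Theorems

namespace AutomaticDesignBelowFourFifths

open Literature.Computability.AlgebraicComplexity (IsSTPP letterCount letterCount_apply sum_letterCount)
open Literature.Computability.AutomaticStructures (digitValue natCast_digitValue_injective)

/-! ## The weight inequality of a digitwise addition -/

/-- **Level weight of a digitwise addition is at least two.** With the level map
`0 ↦ 0`, `[1,q] ↦ 1`, `q+1 ↦ 2` on the first two legs and the reversed map on the third, a digit
relation `x + y = z` (`z ≤ q + 1`) never has level weight `< 2` (Coppersmith–Winograd's `CW_q`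
inside `T_{q+2}^lower`: the support is the six weight-2 patterns and the junk pattern `(1,1,1)`).
[folklore] -/
theorem slicedSTPP_two_le_weight {q i j k x y z : ℕ}
    (hx : i = 0 ∧ x = 0 ∨ i = 1 ∧ 1 ≤ x ∧ x ≤ q ∨ i = 2 ∧ x = q + 1)
    (hy : j = 0 ∧ y = 0 ∨ j = 1 ∧ 1 ≤ y ∧ y ≤ q ∨ j = 2 ∧ y = q + 1)
    (hz : k = 0 ∧ z = q + 1 ∨ k = 1 ∧ 1 ≤ z ∧ z ≤ q ∨ k = 2 ∧ z = 0)
    (h : x + y = z) : 2 ≤ i + j + k := by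
  omega

/-- The weight of a level sequence in terms of its letter counts:
`∑_t I_t = #{I = 1} + 2 #{I = 2}`. [folklore] -/
theorem slicedSTPP_sum_val {N : ℕ} (I : Fin N → Fin 3) :
    ∑ t, (I t : ℕ) = letterCount I 1 + 2 * letterCount I 2 := by
  have hpt : ∀ t, (I t : ℕ) = (if I t = 1 then 1 else 0) + 2 * (if I t = 2 then 1 else 0) := by
    intro t
    generalize I t = v
    fin_cases v <;> simp
  rw [sum_congr rfl fun t _ => hpt t, sum_add_distrib, ← mul_sum, sum_boole, sum_boole,
    letterCount_apply, letterCount_apply, Nat.cast_id, Nat.cast_id]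

/-! ## Grafting a word onto an enumerated class -/

/-- Value of the grafted word `t ↦ ∑_r [g r = t] w r` on the range of an injective enumeration
`g`. [folklore] -/
theorem slicedSTPP_graft_at {a N : ℕ} (g : Fin a → Fin N) (hg : Function.Injective g)
    (w : Fin a → ℕ) (r : Fin a) : (∑ r', if g r' = g r then w r' else 0) = w r := by
  rw [sum_eq_single r (fun r' _ hr' => if_neg fun h => hr' (hg h)) (fun h => absurd (mem_univ r) h),
    if_pos rfl]

/-- The grafted word vanishes off the range. [folklore] -/
theorem slicedSTPP_graft_off {a N : ℕ} (g : Fin a → Fin N) (w : Fin a → ℕ) (t : Fin N)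
    (ht : ∀ r, g r ≠ t) : (∑ r', if g r' = t then w r' else 0) = 0 :=
  sum_eq_zero fun r' _ => if_neg (ht r')

/-- The total of the grafted word is the total of the word. [folklore] -/
theorem slicedSTPP_graft_sum {a N : ℕ} (g : Fin a → Fin N) (w : Fin a → ℕ) :
    (∑ t, ∑ r', if g r' = t then w r' else 0) = ∑ r', w r' := by
  rw [sum_comm]
  exact sum_congr rfl fun r' _ => by rw [sum_ite_eq]; simp

/-! ## The STPP verification from abstract value tables -/

/-- **Kernel of the STPP verification.** Abstract form of the argument: block data
`I J K : Fin n → (Fin N → Fin 3)` separated by the pointwise-weight-2 condition (`hinj`, from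
freeness) with total weight `2N` for every index triple (`hW`, from the types); a valuation `nval`
of `ℕ`-digit vectors in `ℤ/ℓ^N` which is additive, injective below `ℓ` and DIGITWISE on conserved
digit sums (`hdig`, Kummer); and three vector families `Av, Bv, Cv` whose combinations
`Av_i + Bv_i`, `Cv_j - Bv_j`, `Av_k + Cv_k` have the level sequences `I_i, J_j, K_k` (reversed on
the third leg), constant digit sums on the slice `Sl`, and determine their parameters (`hread`).
Then `A_i = nval(Av_i(Sl))`, `B_i = -nval(Bv_i(Sl))`, `C_i = -nval(Cv_i(Sl))` is an `IsSTPP` family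
with all blocks of size `|Sl|`. [cite: CohnKleinbergSzegedyUmans2005, Def. 5.1] -/
theorem slicedSTPP_kernel {n N a q ℓ : ℕ} (hℓ : q + 2 = ℓ)
    (I J K : Fin n → Fin N → Fin 3)
    (hinj : ∀ i j k, (∀ t, (I i t : ℕ) + J j t + K k t = 2) → i = j ∧ j = k)
    (hW : ∀ i j k, ∑ t, ((I i t : ℕ) + J j t + K k t) = 2 * N)
    (nval : (Fin N → ℕ) → ZMod (ℓ ^ N))
    (hadd : ∀ v w : Fin N → ℕ, nval (fun t => v t + w t) = nval v + nval w)
    (hsub : ∀ v w : Fin N → ℕ, (∀ t, w t ≤ v t) → nval (fun t => v t - w t) = nval v - nval w)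
    (hninj : ∀ v w : Fin N → ℕ, (∀ t, v t < ℓ) → (∀ t, w t < ℓ) → nval v = nval w → v = w)
    (hdig : ∀ X Y Z : Fin N → ℕ, (∀ t, X t < ℓ) → (∀ t, Y t < ℓ) → (∀ t, Z t < ℓ) →
      nval X + nval Y = nval Z → ∑ t, X t + ∑ t, Y t = ∑ t, Z t → ∀ t, X t + Y t = Z t)
    (Av Bv Cv : Fin n → (Fin a → Fin q) → Fin N → ℕ)
    (hX : ∀ i κ μ t, ((I i t : ℕ) = 0 ∧ Av i κ t + Bv i μ t = 0) ∨
        ((I i t : ℕ) = 1 ∧ 1 ≤ Av i κ t + Bv i μ t ∧ Av i κ t + Bv i μ t ≤ q) ∨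
        ((I i t : ℕ) = 2 ∧ Av i κ t + Bv i μ t = q + 1))
    (hBC : ∀ j μ ν t, Bv j μ t ≤ Cv j ν t)
    (hY : ∀ j μ ν t, ((J j t : ℕ) = 0 ∧ Cv j ν t - Bv j μ t = 0) ∨
        ((J j t : ℕ) = 1 ∧ 1 ≤ Cv j ν t - Bv j μ t ∧ Cv j ν t - Bv j μ t ≤ q) ∨
        ((J j t : ℕ) = 2 ∧ Cv j ν t - Bv j μ t = q + 1))
    (hZ : ∀ k κ ν t, ((K k t : ℕ) = 0 ∧ Av k κ t + Cv k ν t = q + 1) ∨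
        ((K k t : ℕ) = 1 ∧ 1 ≤ Av k κ t + Cv k ν t ∧ Av k κ t + Cv k ν t ≤ q) ∨
        ((K k t : ℕ) = 2 ∧ Av k κ t + Cv k ν t = 0))
    (Sl : Finset (Fin a → Fin q)) (α β γ : ℕ)
    (hSA : ∀ i, ∀ κ ∈ Sl, ∑ t, Av i κ t = α) (hSB : ∀ i, ∀ μ ∈ Sl, ∑ t, Bv i μ t = β)
    (hSC : ∀ i, ∀ ν ∈ Sl, ∑ t, Cv i ν t = γ)
    (hread : ∀ i κ κ' μ μ' ν ν',
      (∀ t, (Av i κ' t + Bv i μ t) + (Cv i ν t - Bv i μ' t) = Av i κ t + Cv i ν' t) →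
        κ' = κ ∧ μ = μ' ∧ ν = ν')
    (hAinj : ∀ i, Function.Injective (Av i)) (hBinj : ∀ i, Function.Injective (Bv i))
    (hCinj : ∀ i, Function.Injective (Cv i)) :
    IsSTPP (fun i => Sl.image fun κ => nval (Av i κ)) (fun i => Sl.image fun μ => -nval (Bv i μ))
        (fun i => Sl.image fun ν => -nval (Cv i ν)) ∧
      ∀ i, (Sl.image fun κ => nval (Av i κ)).card = Sl.card ∧
        (Sl.image fun μ => -nval (Bv i μ)).card = Sl.card ∧
        (Sl.image fun ν => -nval (Cv i ν)).card = Sl.card := by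
  classical
  -- every single vector is a digit vector
  have hAlt : ∀ i κ t, Av i κ t < ℓ := fun i κ t => by
    rcases hX i κ κ t with h | h | h <;> omega
  have hBlt : ∀ i μ t, Bv i μ t < ℓ := fun i μ t => by
    rcases hX i μ μ t with h | h | h <;> omega
  have hClt : ∀ i ν t, Cv i ν t < ℓ := fun i ν t => by
    rcases hZ i ν ν t with h | h | h <;> omega
  refine ⟨?_, fun i => ⟨card_image_of_injective _ fun κ₁ κ₂ h =>
      hAinj i (hninj _ _ (hAlt i κ₁) (hAlt i κ₂) h),
    card_image_of_injective _ fun μ₁ μ₂ h =>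
      hBinj i (hninj _ _ (hBlt i μ₁) (hBlt i μ₂) (neg_inj.1 h)),
    card_image_of_injective _ fun ν₁ ν₂ h =>
      hCinj i (hninj _ _ (hClt i ν₁) (hClt i ν₂) (neg_inj.1 h))⟩⟩
  intro i j k s hs s' hs' t ht t' ht' u hu u' hu' hrel
  simp only [mem_image] at hs hs' ht ht' hu hu'
  obtain ⟨κ, hκ, rfl⟩ := hs
  obtain ⟨κ', hκ', rfl⟩ := hs'
  obtain ⟨μ, hμ, rfl⟩ := ht
  obtain ⟨μ', hμ', rfl⟩ := ht'
  obtain ⟨ν, hν, rfl⟩ := hu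
  obtain ⟨ν', hν', rfl⟩ := hu'
  -- constants
  have hβγ : β ≤ γ := by
    rw [← hSB j μ' hμ', ← hSC j ν hν]
    exact sum_le_sum fun t _ => hBC j μ' ν t
  -- the relation is `[x] + [y] = [z]`, digitwise by conservation
  have hpt : ∀ t, (Av i κ' t + Bv i μ t) + (Cv j ν t - Bv j μ' t) = Av k κ t + Cv k ν' t := by
    refine hdig (fun t => Av i κ' t + Bv i μ t) (fun t => Cv j ν t - Bv j μ' t)
      (fun t => Av k κ t + Cv k ν' t) (fun t => ?_) (fun t => ?_) (fun t => ?_) ?_ ?_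
    · rcases hX i κ' μ t with h | h | h <;> omega
    · rcases hY j μ' ν t with h | h | h <;> omega
    · rcases hZ k κ ν' t with h | h | h <;> omega
    · rw [hadd, hsub _ _ fun t => hBC j μ' ν t, hadd]
      linear_combination hrel
    · rw [sum_add_distrib, sum_add_distrib, sum_tsub_distrib _ fun t _ => hBC j μ' ν t,
        hSA i κ' hκ', hSB i μ hμ, hSC j ν hν, hSB j μ' hμ', hSA k κ hκ, hSC k ν' hν']
      omega
  -- weight two everywhere, hence the same block thrice
  have hall : ∀ t, (I i t : ℕ) + J j t + K k t = 2 := by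
    have hle : ∀ t ∈ (univ : Finset (Fin N)), (2 : ℕ) ≤ (I i t : ℕ) + J j t + K k t :=
      fun t _ => slicedSTPP_two_le_weight (hX i κ' μ t) (hY j μ' ν t) (hZ k κ ν' t) (hpt t)
    have hsum : ∑ _t : Fin N, (2 : ℕ) = ∑ t, ((I i t : ℕ) + J j t + K k t) := by
      rw [hW i j k, sum_const, card_univ, Fintype.card_fin, smul_eq_mul, mul_comm]
    intro t
    exact ((sum_eq_sum_iff_of_le hle).1 hsum t (mem_univ t)).symm
  obtain ⟨rfl, rfl⟩ := hinj i j k hall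
  obtain ⟨rfl, rfl, rfl⟩ := hread i κ κ' μ μ' ν ν' hpt
  exact ⟨rfl, rfl, rfl, rfl, rfl⟩

end AutomaticDesignBelowFourFifths

end Summit.MatrixMultiplication.MatrixMultiplication.Theorems

end
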